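import Literature.Computability.Cryptography.WordRAMPatternTables
import Mathlib.Data.List.Nodup
import Mathlib.Data.List.OfFn
import HarnessLib

/-!
# The word RAM — deciding a balanced tripartition by brute force (stamped scans)

The small-input branch of the verified algorithm for
`Literature.Computability.AlgebraicComplexity.pratt2024_thm_1_9` (K. Pratt, STOC 2024, Thm. 1.9):
when the word size is too small to address the exponential tables of Pratt's algorithm, the input
is short (its length is below `2^{w/k}`), and the instance is decided by trying all triples of listed
sets. A triple `(S, T, U)` of `n`-subsets of `[3n]` is a tripartition iff the `3n` listed elements
are pairwise distinct, which is tested with a table of *stamps* (no clearing between triples: the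
current triple's number is the stamp). Thirteenth instalment; generic in the layout.

* `scanRes σ b stp es` — the pure model of one scan (table `σ`, collision count `b`, stamp `stp`):
  `scan_snd_eq_iff` — the count does not grow iff the scanned list has no duplicates and none of
  its elements was already stamped;
* `SProg.elemLoop` (registers `82` count, `83` element pointer, `89` table base, `90` stamp,
  `91` collision count, scratch `84–86`) and `elemLoop_spec`;
* `SProg.tripleScan` — the three nested loops over the listed sets of the three families with the
  three scans, the flag update `found := found ∨ (bad = 0)`; **`tripleScan_spec`**: the flag ends
  as `scanFlag` = "old flag, or some triple of listed sets has pairwise distinct elements".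

## References

* K. Pratt, *A stronger connection between the asymptotic rank conjecture and the set cover
  conjecture*, STOC 2024, arXiv:2311.02774, Problem 1.3, Thm. 1.9.
* T. Nipkow, G. Klein, *Concrete Semantics with Isabelle/HOL*, Springer 2014, §12.2.
-/

namespace Literature.Computability.Cryptography.WordRAM

open StateTransition Finset

/-! ## The pure model of a stamped scan -/

/-- One scan step: stamp the element, count a collision if it was already stamped. [folklore] -/
def scanStep (stp : ℕ) (p : (ℕ → ℕ) × ℕ) (e : ℕ) : (ℕ → ℕ) × ℕ :=
  (Function.update p.1 e stp, p.2 + if p.1 e = stp then 1 else 0)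

/-- The scan of a list: final table and collision count. [folklore] -/
def scanRes (stp : ℕ) (σ : ℕ → ℕ) (b : ℕ) (es : List ℕ) : (ℕ → ℕ) × ℕ :=
  es.foldl (scanStep stp) (σ, b)

/-- Scanning nothing. [folklore] -/
@[simp] theorem scanRes_nil (stp : ℕ) (σ : ℕ → ℕ) (b : ℕ) : scanRes stp σ b [] = (σ, b) := rfl

/-- Scanning one more element at the front. [folklore] -/
theorem scanRes_cons (stp : ℕ) (σ : ℕ → ℕ) (b e : ℕ) (es : List ℕ) :
    scanRes stp σ b (e :: es) =
      scanRes stp (Function.update σ e stp) (b + if σ e = stp then 1 else 0) es := rfl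

/-- Scanning one more element at the end. [folklore] -/
theorem scanRes_append_singleton (stp : ℕ) (σ : ℕ → ℕ) (b : ℕ) (es : List ℕ) (e : ℕ) :
    scanRes stp σ b (es ++ [e]) = scanStep stp (scanRes stp σ b es) e := by
  simp [scanRes, List.foldl_append]

/-- Scans concatenate. [folklore] -/
theorem scanRes_append (stp : ℕ) (σ : ℕ → ℕ) (b : ℕ) (es es' : List ℕ) :
    scanRes stp σ b (es ++ es') = scanRes stp (scanRes stp σ b es).1 (scanRes stp σ b es).2 es' := by
  simp [scanRes, List.foldl_append]

/-- The count only grows. [folklore] -/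
theorem le_scanRes_snd (stp : ℕ) : ∀ (es : List ℕ) (σ : ℕ → ℕ) (b : ℕ), b ≤ (scanRes stp σ b es).2
  | [], _, _ => le_rfl
  | e :: es, σ, b => by
    rw [scanRes_cons]
    exact le_trans (Nat.le_add_right _ _) (le_scanRes_snd stp es _ _)

/-- The count is affine in its start. [folklore] -/
theorem scanRes_snd_add (stp : ℕ) : ∀ (es : List ℕ) (σ : ℕ → ℕ) (b c : ℕ),
    (scanRes stp σ (b + c) es).2 = (scanRes stp σ b es).2 + c
  | [], _, _, _ => rfl
  | e :: es, σ, b, c => by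
    rw [scanRes_cons, scanRes_cons, Nat.add_right_comm, scanRes_snd_add stp es]

/-- The table part does not depend on the count. [folklore] -/
theorem scanRes_fst_eq (stp : ℕ) : ∀ (es : List ℕ) (σ : ℕ → ℕ) (b c : ℕ),
    (scanRes stp σ b es).1 = (scanRes stp σ c es).1
  | [], _, _, _ => rfl
  | e :: es, σ, b, c => by rw [scanRes_cons, scanRes_cons]; exact scanRes_fst_eq stp es _ _ _

/-- The final table: stamped on the list, unchanged elsewhere. [folklore] -/
theorem scanRes_fst_apply (stp : ℕ) : ∀ (es : List ℕ) (σ : ℕ → ℕ) (b a : ℕ),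
    (scanRes stp σ b es).1 a = if a ∈ es then stp else σ a
  | [], _, _, _ => by simp
  | e :: es, σ, b, a => by
    rw [scanRes_cons, scanRes_fst_apply stp es]
    by_cases hae : a = e
    · subst hae; simp
    · simp [hae]

/-- **A scan detects duplicates**: the count does not grow iff the list has no duplicates and none of
its elements carried the stamp already. [folklore] -/
theorem scan_snd_eq_iff (stp : ℕ) : ∀ (es : List ℕ) (σ : ℕ → ℕ) (b : ℕ),
    (scanRes stp σ b es).2 = b ↔ es.Nodup ∧ ∀ e ∈ es, σ e ≠ stp
  | [], _, _ => by simp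
  | e :: es, σ, b => by
    rw [scanRes_cons, List.nodup_cons]
    have hmono := le_scanRes_snd stp es (Function.update σ e stp) (b + if σ e = stp then 1 else 0)
    constructor
    · intro h
      have hc : (if σ e = stp then 1 else 0) = 0 := by omega
      have hσe : σ e ≠ stp := by intro hh; simp [hh] at hc
      rw [hc, Nat.add_zero] at h
      obtain ⟨hnd, hall⟩ := (scan_snd_eq_iff stp es _ _).1 h
      refine ⟨⟨fun hmem => ?_, hnd⟩, ?_⟩
      · exact hall e hmem (by simp)
      · intro a ha
        rcases List.mem_cons.1 ha with rfl | ha'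
        · exact hσe
        · have := hall a ha'
          by_cases hae : a = e
          · subst hae; simp at this
          · rwa [Function.update_of_ne hae] at this
    · rintro ⟨⟨hnot, hnd⟩, hall⟩
      have hσe : σ e ≠ stp := hall e (by simp)
      rw [if_neg hσe, Nat.add_zero]
      refine (scan_snd_eq_iff stp es _ _).2 ⟨hnd, fun a ha => ?_⟩
      have hae : a ≠ e := fun h => hnot (h ▸ ha)
      rw [Function.update_of_ne hae]
      exact hall a (List.mem_cons_of_mem _ ha)

/-- Corollary for a fresh stamp: if every table entry is below the stamp, the count stays iff the
list has no duplicates. [folklore] -/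
theorem scan_snd_eq_iff_nodup {stp : ℕ} {es : List ℕ} {σ : ℕ → ℕ} (hσ : ∀ e, σ e < stp) (b : ℕ) :
    (scanRes stp σ b es).2 = b ↔ es.Nodup := by
  rw [scan_snd_eq_iff]
  exact ⟨fun h => h.1, fun h => ⟨h, fun e _ => (hσ e).ne⟩⟩

/-- After a scan with stamp `stp` of a table bounded by `stp`, the table is bounded by `stp`. [folklore] -/
theorem scanRes_fst_le {stp : ℕ} {es : List ℕ} {σ : ℕ → ℕ} (hσ : ∀ e, σ e ≤ stp) (b a : ℕ) :
    (scanRes stp σ b es).1 a ≤ stp := by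
  rw [scanRes_fst_apply]; split_ifs
  · exact le_rfl
  · exact hσ a

/-- The count is at most the start plus the length. [folklore] -/
theorem scanRes_snd_le (stp : ℕ) : ∀ (es : List ℕ) (σ : ℕ → ℕ) (b : ℕ),
    (scanRes stp σ b es).2 ≤ b + es.length
  | [], _, _ => by simp
  | e :: es, σ, b => by
    rw [scanRes_cons]
    refine (scanRes_snd_le stp es _ _).trans ?_
    simp only [List.length_cons]
    split_ifs <;> omega

namespace SProg

variable {w : ℕ} {O : List ℕ → List ℕ}

/-! ## The element loop -/

/-- Body: `e := mem[ep]; a := SB + e; t := mem[a]; t := (t = stamp); bad += t; mem[a] := stamp; ep++; cnt--`.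
[folklore] -/
def elemBody : List OpSpec :=
  [(.add, .dir 84, .ind 83, .imm 0), (.add, .dir 86, .dir 89, .dir 84), (.add, .dir 85, .ind 86, .imm 0),
    (.eq, .dir 85, .dir 85, .dir 90), (.add, .dir 91, .dir 91, .dir 85), (.add, .ind 86, .dir 90, .imm 0),
    (.add, .dir 83, .dir 83, .imm 1), (.sub, .dir 82, .dir 82, .imm 1)]

/-- The element loop. [folklore] -/
def elemLoop : SProg := whilenz (.dir 82) (block elemBody)

/-- The list of `ne` elements at `ep₀`. [folklore] -/
def elemsAt (m : ℕ → ℕ) (ep₀ ne : ℕ) : List ℕ := List.ofFn (n := ne) fun t => m (ep₀ + t)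

/-- Length of `elemsAt`. [folklore] -/
@[simp] theorem length_elemsAt (m : ℕ → ℕ) (ep₀ ne : ℕ) : (elemsAt m ep₀ ne).length = ne := by
  simp [elemsAt]

/-- Prefixes of `elemsAt`. [folklore] -/
theorem elemsAt_take_succ (m : ℕ → ℕ) (ep₀ ne : ℕ) {t : ℕ} (ht : t < ne) :
    (elemsAt m ep₀ ne).take (t + 1) = (elemsAt m ep₀ ne).take t ++ [m (ep₀ + t)] := by
  rw [List.take_succ_eq_append_getElem (by simpa using ht)]
  simp [elemsAt]

/-- The table as read from memory at base `SB` on `[0, E)`. [folklore] -/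
def tableAt (m : ℕ → ℕ) (SB E : ℕ) : ℕ → ℕ := fun e => if e < E then m (SB + e) else 0

/-- Invariant of the element loop after `t` elements (reference memory `m₀` = memory at its start;
`σ₀ = tableAt m₀ SB E`, `b₀` = the count at its start). [folklore] -/
structure ElemInv (m₀ : ℕ → ℕ) (SB E stp ep₀ ne b₀ : ℕ) (qs : List (List ℕ)) (t : ℕ) (st : Store) : Prop where
  queries : st.queries = qs
  r82 : st.mem 82 = ne - t
  r83 : st.mem 83 = ep₀ + t
  r89 : st.mem 89 = SB
  r90 : st.mem 90 = stp
  r91 : st.mem 91 = (scanRes stp (tableAt m₀ SB E) b₀ ((elemsAt m₀ ep₀ ne).take t)).2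
  table : ∀ e, e < E → st.mem (SB + e) = (scanRes stp (tableAt m₀ SB E) b₀ ((elemsAt m₀ ep₀ ne).take t)).1 e
  frame : ∀ c, ¬ (82 ≤ c ∧ c ≤ 86) → c ≠ 91 → ¬ (SB ≤ c ∧ c < SB + E) → st.mem c = m₀ c

set_option linter.unusedSimpArgs false in
/-- One element. [folklore] -/
theorem elemBody_spec {m₀ : ℕ → ℕ} {SB E stp ep₀ ne b₀ : ℕ} {qs : List (List ℕ)} {t : ℕ} (ht : t < ne)
    (hSB : 100 ≤ SB) (hep : 100 ≤ ep₀) (hSBE : SB + E < 2 ^ w) (hepE : ep₀ + ne < 2 ^ w)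
    (hdisj : ep₀ + ne ≤ SB ∨ SB + E ≤ ep₀) (hel : ∀ t, t < ne → m₀ (ep₀ + t) < E)
    (hstp : stp < 2 ^ w) (hb : b₀ + ne < 2 ^ w) (htab : ∀ e, e < E → m₀ (SB + e) < 2 ^ w)
    {st : Store} (h : ElemInv m₀ SB E stp ep₀ ne b₀ qs t st) :
    ∃ st', Exec w O (block elemBody) st st' 8 ∧ ElemInv m₀ SB E stp ep₀ ne b₀ qs (t + 1) st' := by
  obtain ⟨hq, h82, h83, h89, h90, h91, htb, hfr⟩ := h
  obtain ⟨mm, qq⟩ := st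
  simp only at hq h82 h83 h89 h90 h91 htb hfr
  subst qq
  set L := (elemsAt m₀ ep₀ ne).take t with hL
  set σ := (scanRes stp (tableAt m₀ SB E) b₀ L).1 with hσ
  set b := (scanRes stp (tableAt m₀ SB E) b₀ L).2 with hbdef
  have hlenL : L.length = t := by simp [hL, Nat.min_eq_left (le_of_lt ht)]
  have hbt : b ≤ b₀ + t := by have := scanRes_snd_le stp L (tableAt m₀ SB E) b₀; rw [hlenL] at this; exact this
  have hev : mm (ep₀ + t) = m₀ (ep₀ + t) := hfr _ (by omega) (by omega) (by rcases hdisj with hh | hh <;> omega)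
  have heE : m₀ (ep₀ + t) < E := hel t ht
  have hcell : mm (SB + m₀ (ep₀ + t)) = σ (m₀ (ep₀ + t)) := htb _ heE
  have hσv : σ (m₀ (ep₀ + t)) < 2 ^ w := by
    rw [hσ, scanRes_fst_apply]; split_ifs
    · exact hstp
    · simp only [tableAt, if_pos heE]; exact htab _ heE
  have hcmp : (if σ (m₀ (ep₀ + t)) = stp then 1 else 0) ≤ 1 := by split_ifs <;> omega
  refine Exec.block_of_fwd elemBody qs fun Rf hR => ?_
  unfold elemBody at hR
  have htmp := execOps_cons_fwd hR; clear hR; obtain ⟨v1, hv1, hR⟩ := htmp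
  simp -failIfUnchanged (disch := omega) only [Operand.write, Operand.read,
    Function.update_self, Function.update_of_ne, BinOp.eval_add_mod', BinOp.eval_mul_mod',
    Nat.mod_eq_of_lt, BinOp.eval_sub_of_le, BinOp.eval_lt, BinOp.eval_eq, Nat.add_zero, h83, hev] at hv1 hR
  subst v1
  have htmp := execOps_cons_fwd hR; clear hR; obtain ⟨v2, hv2, hR⟩ := htmp
  simp -failIfUnchanged (disch := omega) only [Operand.write, Operand.read,
    Function.update_self, Function.update_of_ne, BinOp.eval_add_mod', BinOp.eval_mul_mod',
    Nat.mod_eq_of_lt, BinOp.eval_sub_of_le, BinOp.eval_lt, BinOp.eval_eq, Nat.add_zero, h89] at hv2 hR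
  subst v2
  have htmp := execOps_cons_fwd hR; clear hR; obtain ⟨v3, hv3, hR⟩ := htmp
  simp -failIfUnchanged (disch := omega) only [Operand.write, Operand.read,
    Function.update_self, Function.update_of_ne, BinOp.eval_add_mod', BinOp.eval_mul_mod',
    Nat.mod_eq_of_lt, BinOp.eval_sub_of_le, BinOp.eval_lt, BinOp.eval_eq, Nat.add_zero, hcell] at hv3 hR
  subst v3
  have htmp := execOps_cons_fwd hR; clear hR; obtain ⟨v4, hv4, hR⟩ := htmp
  simp -failIfUnchanged (disch := omega) only [Operand.write, Operand.read,
    Function.update_self, Function.update_of_ne, BinOp.eval_add_mod', BinOp.eval_mul_mod',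
    Nat.mod_eq_of_lt, BinOp.eval_sub_of_le, BinOp.eval_lt, BinOp.eval_eq, Nat.add_zero, h90] at hv4 hR
  subst v4
  have htmp := execOps_cons_fwd hR; clear hR; obtain ⟨v5, hv5, hR⟩ := htmp
  simp -failIfUnchanged (disch := omega) only [Operand.write, Operand.read,
    Function.update_self, Function.update_of_ne, BinOp.eval_add_mod', BinOp.eval_mul_mod',
    Nat.mod_eq_of_lt, BinOp.eval_sub_of_le, BinOp.eval_lt, BinOp.eval_eq, Nat.add_zero, h91] at hv5 hR
  subst v5
  have htmp := execOps_cons_fwd hR; clear hR; obtain ⟨v6, hv6, hR⟩ := htmp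
  simp -failIfUnchanged (disch := omega) only [Operand.write, Operand.read,
    Function.update_self, Function.update_of_ne, BinOp.eval_add_mod', BinOp.eval_mul_mod',
    Nat.mod_eq_of_lt, BinOp.eval_sub_of_le, BinOp.eval_lt, BinOp.eval_eq, Nat.add_zero, h90] at hv6 hR
  subst v6
  have htmp := execOps_cons_fwd hR; clear hR; obtain ⟨v7, hv7, hR⟩ := htmp
  simp -failIfUnchanged (disch := omega) only [Operand.write, Operand.read,
    Function.update_self, Function.update_of_ne, BinOp.eval_add_mod', BinOp.eval_mul_mod',
    Nat.mod_eq_of_lt, BinOp.eval_sub_of_le, BinOp.eval_lt, BinOp.eval_eq, Nat.add_zero, h83] at hv7 hR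
  subst v7
  have htmp := execOps_cons_fwd hR; clear hR; obtain ⟨v8, hv8, hR⟩ := htmp
  simp -failIfUnchanged (disch := omega) only [Operand.write, Operand.read,
    Function.update_self, Function.update_of_ne, BinOp.eval_add_mod', BinOp.eval_mul_mod',
    Nat.mod_eq_of_lt, BinOp.eval_sub_of_le, BinOp.eval_lt, BinOp.eval_eq, Nat.add_zero, h82] at hv8 hR
  subst v8
  simp only [execOps_nil] at hR
  subst hR
  have hstep : scanRes stp (tableAt m₀ SB E) b₀ ((elemsAt m₀ ep₀ ne).take (t + 1)) =
      scanStep stp (σ, b) (m₀ (ep₀ + t)) := by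
    rw [elemsAt_take_succ m₀ ep₀ ne ht, scanRes_append_singleton]
  refine ⟨rfl, ?_, ?_, ?_, ?_, ?_, fun e he => ?_, fun c hc hc91 hnc => ?_⟩ <;> dsimp only
  · simp (disch := omega) only [Function.update_of_ne, Function.update_self]; omega
  · simp (disch := omega) only [Function.update_of_ne, Function.update_self]; omega
  · simp (disch := omega) only [Function.update_of_ne, Function.update_self]; exact h89
  · simp (disch := omega) only [Function.update_of_ne, Function.update_self]; exact h90
  · simp (disch := omega) only [Function.update_of_ne, Function.update_self]
    rw [hstep, scanStep]
  · simp (disch := omega) only [Function.update_of_ne, Function.update_self]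
    rw [hstep, scanStep]
    dsimp only
    by_cases hee : e = m₀ (ep₀ + t)
    · subst hee
      rw [Function.update_self]
      simp (disch := omega) only [Function.update_of_ne, Function.update_self]
    · rw [Function.update_of_ne hee]
      simp (disch := omega) only [Function.update_of_ne, Function.update_self]
      exact htb e he
  · simp (disch := omega) only [Function.update_of_ne, Function.update_self]
    exact hfr c hc hc91 hnc

/-- **The element loop**: a whole scan within `10 ne + 1` steps. [folklore] -/
theorem elemLoop_spec {m₀ : ℕ → ℕ} {SB E stp ep₀ ne b₀ : ℕ} {qs : List (List ℕ)}
    (hSB : 100 ≤ SB) (hep : 100 ≤ ep₀) (hSBE : SB + E < 2 ^ w) (hepE : ep₀ + ne < 2 ^ w)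
    (hdisj : ep₀ + ne ≤ SB ∨ SB + E ≤ ep₀) (hel : ∀ t, t < ne → m₀ (ep₀ + t) < E)
    (hstp : stp < 2 ^ w) (hb : b₀ + ne < 2 ^ w) (htab : ∀ e, e < E → m₀ (SB + e) < 2 ^ w)
    {st : Store} (h : ElemInv m₀ SB E stp ep₀ ne b₀ qs 0 st) :
    ∃ st', ExecLE w O elemLoop st st' (ne * 10 + 1) ∧ ElemInv m₀ SB E stp ep₀ ne b₀ qs ne st' :=
  ExecLE.whilenz_invariant (w := w) (O := O) (x := .dir 82) (s := block elemBody) ne 8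
    (fun t st => ElemInv m₀ SB E stp ep₀ ne b₀ qs t st)
    (fun t ht st hst => ⟨by rw [Operand.read_dir, hst.r82]; omega,
      by obtain ⟨st', hex, hinv⟩ := elemBody_spec (w := w) (O := O) ht hSB hep hSBE hepE hdisj hel hstp
           hb htab hst
         exact ⟨st', hex.execLE, hinv⟩⟩)
    (fun st hst => by rw [Operand.read_dir, hst.r82]; omega) h

/-! ## One set: pointer set-up and a scan -/

/-- `ep := p + 1; cnt := n₀` for the set whose card word is at the address in register `P`. [folklore] -/
def setOps (P : ℕ) : List OpSpec :=
  [(.add, .dir 83, .dir P, .imm 1), (.add, .dir 82, .dir 3, .imm 0)]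

/-- Scan the set at register `P`. [folklore] -/
def scanSet (P : ℕ) : SProg := seq (block (setOps P)) elemLoop

/-- The static data of the scans: table base `SB` of size `E`, `n₀` elements per set. [folklore] -/
structure ScanSide (w : ℕ) (SB E n₀ : ℕ) : Prop where
  hSB : 100 ≤ SB
  hSBE : SB + E < 2 ^ w
  hn₀ : n₀ < 2 ^ w

set_option linter.unusedSimpArgs false in
/-- **Scanning one set.** From a memory `m` with `n₀` in `3`, `SB` in `89`, the stamp `stp` in `90`,
the count `b` in `91` and the card-word address `p` of a set in register `P ∈ {95, 96, 97}` (elements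
at `p + 1, …, p + n₀`, all `< E`, the set below or above the table), `scanSet P` ends within
`10 n₀ + 3` steps with `91 = (scanRes stp (tableAt m SB E) b (elemsAt m (p+1) n₀)).2`, the table
updated accordingly, and nothing else changed outside `82–86`, `91` and the table. [folklore] -/
theorem scanSet_spec {m : ℕ → ℕ} {SB E n₀ stp b p P : ℕ} (hS : ScanSide w SB E n₀)
    (hP : P = 95 ∨ P = 96 ∨ P = 97) (h3 : m 3 = n₀) (h89 : m 89 = SB) (h90 : m 90 = stp)
    (h91 : m 91 = b) (hPv : m P = p) (hp : 100 ≤ p) (hpE : p + 1 + n₀ < 2 ^ w)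
    (hdisj : p + 1 + n₀ ≤ SB ∨ SB + E ≤ p + 1) (hel : ∀ t, t < n₀ → m (p + 1 + t) < E)
    (hstp : stp < 2 ^ w) (hb : b + n₀ < 2 ^ w) (htab : ∀ e, e < E → m (SB + e) < 2 ^ w)
    (qs : List (List ℕ)) :
    ∃ st', ExecLE w O (scanSet P) ⟨m, qs⟩ st' (n₀ * 10 + 3) ∧
      ElemInv m SB E stp (p + 1) n₀ b qs n₀ st' := by
  have hSB := hS.hSB; have hSBE := hS.hSBE; have hn₀ := hS.hn₀
  have hP100 : P < 100 := by omega
  have hP82 : ¬ (82 ≤ P ∧ P ≤ 86) := by omega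
  obtain ⟨st₁, hex₁, hI⟩ : ∃ st', Exec w O (block (setOps P)) ⟨m, qs⟩ st' 2 ∧
      ElemInv m SB E stp (p + 1) n₀ b qs 0 st' := by
    refine Exec.block_of_fwd (setOps P) qs fun Rf hR => ?_
    unfold setOps at hR
    have htmp := execOps_cons_fwd hR; clear hR; obtain ⟨v1, hv1, hR⟩ := htmp
    simp -failIfUnchanged (disch := omega) only [Operand.write, Operand.read,
      Function.update_self, Function.update_of_ne, BinOp.eval_add_mod', Nat.mod_eq_of_lt,
      Nat.add_zero, hPv] at hv1 hR
    subst v1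
    have htmp := execOps_cons_fwd hR; clear hR; obtain ⟨v2, hv2, hR⟩ := htmp
    simp -failIfUnchanged (disch := omega) only [Operand.write, Operand.read,
      Function.update_self, Function.update_of_ne, BinOp.eval_add_mod', Nat.mod_eq_of_lt,
      Nat.add_zero, h3] at hv2 hR
    subst v2
    simp only [execOps_nil] at hR
    subst hR
    refine ⟨rfl, ?_, ?_, ?_, ?_, ?_, fun e he => ?_, fun c hc hc91 hnc => ?_⟩ <;> dsimp only
    · simp (disch := omega) only [Function.update_of_ne, Function.update_self]; try omega
    · simp (disch := omega) only [Function.update_of_ne, Function.update_self]; try omega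
    · simp (disch := omega) only [Function.update_of_ne, Function.update_self]; exact h89
    · simp (disch := omega) only [Function.update_of_ne, Function.update_self]; exact h90
    · simp (disch := omega) only [Function.update_of_ne, Function.update_self]; exact h91
    · simp (disch := omega) only [Function.update_of_ne, Function.update_self]
      simp [tableAt, he]
    · simp (disch := omega) only [Function.update_of_ne, Function.update_self]
  obtain ⟨st₂, hex₂, hI₂⟩ := elemLoop_spec (w := w) (O := O) hSB (by omega) hSBE (by omega) hdisj hel
    hstp hb htab hI
  refine ⟨st₂, (ExecLE.seq hex₁.execLE hex₂).mono (by omega), ?_⟩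
  simpa using hI₂

/-! ## Three scans with one stamp -/

/-- The table read from a memory that holds a scan result IS that scan result (elements `< E`). [folklore] -/
theorem tableAt_eq_of_scan {m m₁ : ℕ → ℕ} {SB E stp b : ℕ} {L : List ℕ}
    (htab : ∀ e, e < E → m₁ (SB + e) = (scanRes stp (tableAt m SB E) b L).1 e)
    (hL : ∀ e ∈ L, e < E) : tableAt m₁ SB E = (scanRes stp (tableAt m SB E) b L).1 := by
  funext e
  by_cases he : e < E
  · rw [← htab e he]; simp [tableAt, he]
  · rw [scanRes_fst_apply, if_neg (fun hm => he (hL e hm))]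
    simp [tableAt, he]

/-- Elements of `elemsAt` are the listed words. [folklore] -/
theorem mem_elemsAt {m : ℕ → ℕ} {ep ne e : ℕ} (h : e ∈ elemsAt m ep ne) : ∃ t, t < ne ∧ m (ep + t) = e := by
  simp only [elemsAt, List.mem_ofFn] at h
  obtain ⟨t, rfl⟩ := h
  exact ⟨t, t.2, rfl⟩

/-- `elemsAt` only reads its own cells. [folklore] -/
theorem elemsAt_congr {m m' : ℕ → ℕ} {ep ne : ℕ} (h : ∀ t, t < ne → m' (ep + t) = m (ep + t)) :
    elemsAt m' ep ne = elemsAt m ep ne := by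
  simp only [elemsAt]
  congr 1
  funext t
  exact h t t.2

/-- The three scans of one triple. [folklore] -/
def threeScans : SProg := seq (scanSet 95) (seq (scanSet 96) (scanSet 97))

/-- **Three scans with a fresh stamp**: the count register ends with the collision count of the
concatenated element lists scanned against a table all of whose entries were below the stamp.
[folklore] -/
theorem threeScans_spec {m : ℕ → ℕ} {SB E n₀ stp : ℕ} {p : ℕ → ℕ} (hS : ScanSide w SB E n₀)
    (h3 : m 3 = n₀) (h89 : m 89 = SB) (h90 : m 90 = stp) (h91 : m 91 = 0) (h95 : m 95 = p 0)
    (h96 : m 96 = p 1) (h97 : m 97 = p 2) (hp : ∀ i, i < 3 → 100 ≤ p i ∧ p i + 1 + n₀ < 2 ^ w)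
    (hdisj : ∀ i, i < 3 → p i + 1 + n₀ ≤ SB ∨ SB + E ≤ p i + 1)
    (hel : ∀ i t, i < 3 → t < n₀ → m (p i + 1 + t) < E) (hstp : stp < 2 ^ w) (hstp1 : 1 ≤ stp)
    (h3n : 3 * n₀ < 2 ^ w) (htab : ∀ e, e < E → m (SB + e) < stp) (qs : List (List ℕ)) :
    ∃ st', ExecLE w O threeScans ⟨m, qs⟩ st' (n₀ * 30 + 9) ∧ st'.queries = qs ∧
      st'.mem 91 = (scanRes stp (tableAt m SB E) 0
        (elemsAt m (p 0 + 1) n₀ ++ elemsAt m (p 1 + 1) n₀ ++ elemsAt m (p 2 + 1) n₀)).2 ∧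
      (∀ e, e < E → st'.mem (SB + e) ≤ stp) ∧
      (∀ c, ¬ (82 ≤ c ∧ c ≤ 86) → c ≠ 91 → ¬ (SB ≤ c ∧ c < SB + E) → st'.mem c = m c) := by
  have hSB := hS.hSB; have hSBE := hS.hSBE
  have hp0 := hp 0 (by norm_num); have hp1 := hp 1 (by norm_num); have hp2 := hp 2 (by norm_num)
  have htabw : ∀ e, e < E → m (SB + e) < 2 ^ w := fun e he => (htab e he).trans hstp
  have hσle : ∀ e, tableAt m SB E e ≤ stp := fun e => by
    unfold tableAt; split_ifs with he
    · exact (htab e he).le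
    · omega
  have hσlt : ∀ e, tableAt m SB E e < stp := fun e => by
    unfold tableAt; split_ifs with he
    · exact htab e he
    · omega
  -- first scan
  obtain ⟨st₁, hex₁, hI₁⟩ := scanSet_spec (w := w) (O := O) (P := 95) hS (by norm_num) h3 h89 h90 h91 h95
    hp0.1 hp0.2 (hdisj 0 (by norm_num)) (fun t ht => hel 0 t (by norm_num) ht) hstp (by omega) htabw qs
  obtain ⟨L0, hL0⟩ : ∃ L0, elemsAt m (p 0 + 1) n₀ = L0 := ⟨_, rfl⟩
  have hL0len : L0.length = n₀ := by rw [← hL0]; simp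
  have hL0E : ∀ e ∈ L0, e < E := fun e he => by
    rw [← hL0] at he
    obtain ⟨t, ht, rfl⟩ := mem_elemsAt he; exact hel 0 t (by norm_num) ht
  obtain ⟨hq₁, _, _, g89, g90, g91, gtab, gfr⟩ := hI₁
  rw [hL0, List.take_of_length_le (by omega)] at g91 gtab
  obtain ⟨mm₁, qq₁⟩ := st₁
  simp only at hq₁ g89 g90 g91 gtab gfr
  subst qq₁
  have hT1 : tableAt mm₁ SB E = (scanRes stp (tableAt m SB E) 0 L0).1 := tableAt_eq_of_scan gtab hL0E
  have hrd1 : ∀ c, 100 ≤ c → ¬ (SB ≤ c ∧ c < SB + E) → mm₁ c = m c := fun c hc hnc =>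
    gfr c (by omega) (by omega) hnc
  have hel1 : ∀ t, t < n₀ → mm₁ (p 1 + 1 + t) = m (p 1 + 1 + t) := fun t ht =>
    hrd1 _ (by omega) (by rcases hdisj 1 (by norm_num) with hh | hh <;> omega)
  have hel2 : ∀ t, t < n₀ → mm₁ (p 2 + 1 + t) = m (p 2 + 1 + t) := fun t ht =>
    hrd1 _ (by omega) (by rcases hdisj 2 (by norm_num) with hh | hh <;> omega)
  have htab1 : ∀ e, e < E → mm₁ (SB + e) < 2 ^ w := fun e he => by
    rw [gtab e he]; exact (scanRes_fst_le hσle _ _).trans_lt hstp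
  have hb1 : (scanRes stp (tableAt m SB E) 0 L0).2 ≤ n₀ := by
    have := scanRes_snd_le stp L0 (tableAt m SB E) 0; omega
  -- second scan
  obtain ⟨st₂, hex₂, hI₂⟩ := scanSet_spec (w := w) (O := O) (P := 96) hS (by norm_num)
    (by rw [gfr 3 (by omega) (by omega) (by omega)]; exact h3) g89 g90 g91
    (by rw [gfr 96 (by omega) (by omega) (by omega)]; exact h96) hp1.1 hp1.2 (hdisj 1 (by norm_num))
    (fun t ht => by rw [hel1 t ht]; exact hel 1 t (by norm_num) ht) hstp (by omega) htab1 qs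
  obtain ⟨L1, hL1⟩ : ∃ L1, elemsAt m (p 1 + 1) n₀ = L1 := ⟨_, rfl⟩
  have hL1len : L1.length = n₀ := by rw [← hL1]; simp
  have hL1E : ∀ e ∈ L1, e < E := fun e he => by
    rw [← hL1] at he
    obtain ⟨t, ht, rfl⟩ := mem_elemsAt he; exact hel 1 t (by norm_num) ht
  have hL1' : elemsAt mm₁ (p 1 + 1) n₀ = L1 := (elemsAt_congr hel1).trans hL1
  obtain ⟨hq₂, _, _, k89, k90, k91, ktab, kfr⟩ := hI₂
  rw [hL1', List.take_of_length_le (by omega), hT1] at k91 ktab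
  rw [← scanRes_append] at k91 ktab
  obtain ⟨mm₂, qq₂⟩ := st₂
  simp only at hq₂ k89 k90 k91 ktab kfr
  subst qq₂
  have hL01E : ∀ e ∈ L0 ++ L1, e < E := fun e he => by
    rcases List.mem_append.1 he with h | h
    exacts [hL0E e h, hL1E e h]
  have hT2 : tableAt mm₂ SB E = (scanRes stp (tableAt m SB E) 0 (L0 ++ L1)).1 :=
    tableAt_eq_of_scan ktab hL01E
  have hrd2 : ∀ c, 100 ≤ c → ¬ (SB ≤ c ∧ c < SB + E) → mm₂ c = m c := fun c hc hnc => by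
    rw [kfr c (by omega) (by omega) hnc]; exact hrd1 c hc hnc
  have hel2' : ∀ t, t < n₀ → mm₂ (p 2 + 1 + t) = m (p 2 + 1 + t) := fun t ht =>
    hrd2 _ (by omega) (by rcases hdisj 2 (by norm_num) with hh | hh <;> omega)
  have htab2 : ∀ e, e < E → mm₂ (SB + e) < 2 ^ w := fun e he => by
    rw [ktab e he]; exact (scanRes_fst_le hσle _ _).trans_lt hstp
  have hb2 : (scanRes stp (tableAt m SB E) 0 (L0 ++ L1)).2 ≤ 2 * n₀ := by
    have := scanRes_snd_le stp (L0 ++ L1) (tableAt m SB E) 0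
    rw [List.length_append] at this; omega
  -- third scan
  obtain ⟨st₃, hex₃, hI₃⟩ := scanSet_spec (w := w) (O := O) (P := 97) hS (by norm_num)
    (by rw [kfr 3 (by omega) (by omega) (by omega), gfr 3 (by omega) (by omega) (by omega)]; exact h3)
    k89 k90 k91
    (by rw [kfr 97 (by omega) (by omega) (by omega), gfr 97 (by omega) (by omega) (by omega)]; exact h97)
    hp2.1 hp2.2 (hdisj 2 (by norm_num))
    (fun t ht => by rw [hel2' t ht]; exact hel 2 t (by norm_num) ht) hstp (by omega) htab2 qs
  obtain ⟨L2, hL2⟩ : ∃ L2, elemsAt m (p 2 + 1) n₀ = L2 := ⟨_, rfl⟩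
  have hL2len : L2.length = n₀ := by rw [← hL2]; simp
  have hL2' : elemsAt mm₂ (p 2 + 1) n₀ = L2 := (elemsAt_congr hel2').trans hL2
  obtain ⟨hq₃, _, _, _, _, l91, ltab, lfr⟩ := hI₃
  rw [hL2', List.take_of_length_le (by omega), hT2] at l91 ltab
  rw [← scanRes_append] at l91 ltab
  rw [hL0, hL1, hL2]
  refine ⟨st₃, ((hex₁.seq (hex₂.seq hex₃))).mono (by omega), hq₃, l91, fun e he => ?_,
    fun c hc hc91 hnc => ?_⟩
  · rw [ltab e he]; exact scanRes_fst_le hσle _ _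
  · rw [lfr c hc hc91 hnc, kfr c hc hc91 hnc]; exact gfr c hc hc91 hnc

/-! ## The three loops over the listed sets -/

/-- The layout of the brute-force scan: `n₀` elements per set, stride `s` between consecutive sets of a
family, address `A i` of the first card word of family `i`, `len i` listed sets, the stamp table at
`SB` (size `E`), the initial stamp `stamp₀` and flag `found₀`. [folklore] -/
structure ScanLayout where
  /-- Elements per set. -/
  n₀ : ℕ
  /-- Words per listed set. -/
  s : ℕ
  /-- Address of the first card word of family `i`. -/
  A : ℕ → ℕ
  /-- Number of listed sets of family `i`. -/
  len : ℕ → ℕ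
  /-- Base of the stamp table. -/
  SB : ℕ
  /-- Size of the stamp table (elements are `< E`). -/
  E : ℕ
  /-- The stamp before the scan. -/
  stamp₀ : ℕ
  /-- The flag before the scan. -/
  found₀ : ℕ

/-- Address of the card word of the `j`-th set of family `i`. [folklore] -/
def ScanLayout.ptr (Lay : ScanLayout) (i j : ℕ) : ℕ := Lay.A i + j * Lay.s

/-- The triple `(a, b, c)` of listed sets has pairwise distinct elements. [cite: Pratt2024SCC, Problem 1.3] -/
def goodTriple (m : ℕ → ℕ) (Lay : ScanLayout) (a b c : ℕ) : Prop :=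
  (elemsAt m (Lay.ptr 0 a + 1) Lay.n₀ ++ elemsAt m (Lay.ptr 1 b + 1) Lay.n₀ ++
    elemsAt m (Lay.ptr 2 c + 1) Lay.n₀).Nodup

/-- The rank of a triple in the order in which the loops visit them. [folklore] -/
def ScanLayout.rank (Lay : ScanLayout) (a b c : ℕ) : ℕ := (a * Lay.len 1 + b) * Lay.len 2 + c

/-- The flag after the triples of rank `< N`: the old flag, or a good triple of rank `< N`.
[folklore] -/
def ScanFlag (m : ℕ → ℕ) (Lay : ScanLayout) (N : ℕ) : Prop :=
  Lay.found₀ ≠ 0 ∨ ∃ a b c, a < Lay.len 0 ∧ b < Lay.len 1 ∧ c < Lay.len 2 ∧ Lay.rank a b c < N ∧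
    goodTriple m Lay a b c

/-- A proposition as a word. [folklore] -/
noncomputable def flagOf (P : Prop) : ℕ := by classical exact if P then 1 else 0

/-- `flagOf` of a true proposition. [folklore] -/
theorem flagOf_pos {P : Prop} (h : P) : flagOf P = 1 := by
  unfold flagOf; rw [if_pos h]

/-- `flagOf` of a false proposition. [folklore] -/
theorem flagOf_neg {P : Prop} (h : ¬ P) : flagOf P = 0 := by
  unfold flagOf; rw [if_neg h]

/-- `flagOf ≤ 1`. [folklore] -/
theorem flagOf_le_one (P : Prop) : flagOf P ≤ 1 := by
  by_cases h : P
  · rw [flagOf_pos h]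
  · rw [flagOf_neg h]; exact Nat.zero_le _

/-- The machine's disjunction of two flags. [folklore] -/
theorem flagOf_or (P Q : Prop) :
    flagOf (P ∨ Q) = if 0 < flagOf P + flagOf Q then 1 else 0 := by
  by_cases hP : P
  · rw [flagOf_pos (Or.inl hP), flagOf_pos hP]; simp
  · by_cases hQ : Q
    · rw [flagOf_pos (Or.inr hQ), flagOf_neg hP, flagOf_pos hQ]; simp
    · rw [flagOf_neg (by tauto), flagOf_neg hP, flagOf_neg hQ]; simp

/-- The coordinates of a rank inside the box. [folklore] -/
theorem ScanLayout.rank_coords (Lay : ScanLayout) {a b c : ℕ} (hb : b < Lay.len 1) (hc : c < Lay.len 2) :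
    Lay.rank a b c % Lay.len 2 = c ∧ Lay.rank a b c / Lay.len 2 % Lay.len 1 = b ∧
      Lay.rank a b c / Lay.len 2 / Lay.len 1 = a := by
  have h2 : 0 < Lay.len 2 := by omega
  have h1 : 0 < Lay.len 1 := by omega
  unfold ScanLayout.rank
  have hd : ((a * Lay.len 1 + b) * Lay.len 2 + c) / Lay.len 2 = a * Lay.len 1 + b := by
    rw [Nat.mul_comm, Nat.mul_add_div h2, Nat.div_eq_of_lt hc, Nat.add_zero]
  refine ⟨by rw [Nat.mul_add_mod_of_lt hc], ?_, ?_⟩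
  · rw [hd, Nat.mul_add_mod_of_lt hb]
  · rw [hd, Nat.mul_comm, Nat.mul_add_div h1, Nat.div_eq_of_lt hb, Nat.add_zero]

/-- The rank is injective on the box. [folklore] -/
theorem ScanLayout.rank_inj (Lay : ScanLayout) {a b c a' b' c' : ℕ} (hb : b < Lay.len 1) (hc : c < Lay.len 2)
    (hb' : b' < Lay.len 1) (hc' : c' < Lay.len 2) (h : Lay.rank a b c = Lay.rank a' b' c') :
    a = a' ∧ b = b' ∧ c = c' := by
  obtain ⟨e1, e2, e3⟩ := Lay.rank_coords hb hc
  obtain ⟨f1, f2, f3⟩ := Lay.rank_coords hb' hc'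
  rw [h] at e1 e2 e3
  exact ⟨e3.symm.trans f3, e2.symm.trans f2, e1.symm.trans f1⟩

/-- Ranks inside the box are below `len 0 · len 1 · len 2`. [folklore] -/
theorem ScanLayout.rank_lt (Lay : ScanLayout) {a b c : ℕ} (ha : a < Lay.len 0) (hb : b < Lay.len 1)
    (hc : c < Lay.len 2) : Lay.rank a b c < Lay.rank (Lay.len 0) 0 0 := by
  unfold ScanLayout.rank
  have h1 : a * Lay.len 1 + b + 1 ≤ Lay.len 0 * Lay.len 1 := by nlinarith
  have h2 : (a * Lay.len 1 + b + 1) * Lay.len 2 ≤ Lay.len 0 * Lay.len 1 * Lay.len 2 :=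
    Nat.mul_le_mul_right _ h1
  nlinarith

/-- One more triple: the flag of rank `N + 1` is the flag of rank `N` or the goodness of the triple
of rank `N`. [folklore] -/
theorem scanFlag_succ (m : ℕ → ℕ) (Lay : ScanLayout) {j₀ j₁ j₂ : ℕ} (h₀ : j₀ < Lay.len 0)
    (h₁ : j₁ < Lay.len 1) (h₂ : j₂ < Lay.len 2) :
    ScanFlag m Lay (Lay.rank j₀ j₁ j₂ + 1) ↔ ScanFlag m Lay (Lay.rank j₀ j₁ j₂) ∨ goodTriple m Lay j₀ j₁ j₂ := by
  unfold ScanFlag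
  constructor
  · rintro (hf | ⟨a, b, c, ha, hb, hc, hlt, hg⟩)
    · exact Or.inl (Or.inl hf)
    · rcases Nat.lt_succ_iff_lt_or_eq.1 hlt with hlt' | heq
      · exact Or.inl (Or.inr ⟨a, b, c, ha, hb, hc, hlt', hg⟩)
      · obtain ⟨rfl, rfl, rfl⟩ := Lay.rank_inj hb hc h₁ h₂ heq
        exact Or.inr hg
  · rintro ((hf | ⟨a, b, c, ha, hb, hc, hlt, hg⟩) | hg)
    · exact Or.inl hf
    · exact Or.inr ⟨a, b, c, ha, hb, hc, by omega, hg⟩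
    · exact Or.inr ⟨j₀, j₁, j₂, h₀, h₁, h₂, by omega, hg⟩

/-- All triples: the final flag. [folklore] -/
theorem scanFlag_final (m : ℕ → ℕ) (Lay : ScanLayout) :
    ScanFlag m Lay (Lay.rank (Lay.len 0) 0 0) ↔
      Lay.found₀ ≠ 0 ∨ ∃ a b c, a < Lay.len 0 ∧ b < Lay.len 1 ∧ c < Lay.len 2 ∧ goodTriple m Lay a b c := by
  unfold ScanFlag
  refine or_congr Iff.rfl ⟨?_, ?_⟩
  · rintro ⟨a, b, c, ha, hb, hc, _, hg⟩; exact ⟨a, b, c, ha, hb, hc, hg⟩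
  · rintro ⟨a, b, c, ha, hb, hc, hg⟩; exact ⟨a, b, c, ha, hb, hc, Lay.rank_lt ha hb hc, hg⟩

/-- No triple yet: the initial flag. [folklore] -/
theorem scanFlag_zero (m : ℕ → ℕ) (Lay : ScanLayout) : ScanFlag m Lay 0 ↔ Lay.found₀ ≠ 0 := by
  unfold ScanFlag; simp

/-- Static side conditions of the brute-force scan. [folklore] -/
structure BFSide (w : ℕ) (m : ℕ → ℕ) (Lay : ScanLayout) : Prop where
  hA : ∀ i, i < 3 → 100 ≤ Lay.A i ∧ Lay.A i + Lay.len i * Lay.s < 2 ^ w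
  hs : Lay.n₀ + 1 ≤ Lay.s
  hSB : 100 ≤ Lay.SB
  hSBE : Lay.SB + Lay.E < 2 ^ w
  h3n : 3 * Lay.n₀ < 2 ^ w
  hAT : ∀ i, i < 3 → Lay.A i + Lay.len i * Lay.s ≤ Lay.SB ∨ Lay.SB + Lay.E ≤ Lay.A i
  hel : ∀ i j t, i < 3 → j < Lay.len i → t < Lay.n₀ → m (Lay.ptr i j + 1 + t) < Lay.E
  hstamp : Lay.stamp₀ + Lay.rank (Lay.len 0) 0 0 + 1 < 2 ^ w
  htab : ∀ e, e < Lay.E → m (Lay.SB + e) ≤ Lay.stamp₀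
  hfound : Lay.found₀ ≤ 1
  hlen : ∀ i, i < 3 → Lay.len i < 2 ^ w
  hw : 2 ≤ w

/-- Values of the read-only registers of the scan. [folklore] -/
structure BFRegs (m : ℕ → ℕ) (Lay : ScanLayout) : Prop where
  r3 : m 3 = Lay.n₀
  r73 : m 73 = Lay.s
  r74 : m 74 = Lay.A 0
  r75 : m 75 = Lay.A 1
  r76 : m 76 = Lay.A 2
  r77 : m 77 = Lay.len 0
  r78 : m 78 = Lay.len 1
  r79 : m 79 = Lay.len 2
  r89 : m 89 = Lay.SB
  r90 : m 90 = Lay.stamp₀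
  r81 : m 81 = Lay.found₀

/-- A set pointer inside its family. [folklore] -/
theorem ptr_bounds {Lay : ScanLayout} {i j : ℕ} (hA : 100 ≤ Lay.A i ∧ Lay.A i + Lay.len i * Lay.s < 2 ^ w)
    (hs : Lay.n₀ + 1 ≤ Lay.s) (hj : j < Lay.len i) :
    100 ≤ Lay.ptr i j ∧ Lay.ptr i j + 1 + Lay.n₀ < 2 ^ w ∧ Lay.ptr i j + Lay.s ≤ Lay.A i + Lay.len i * Lay.s := by
  have hjs : j * Lay.s + Lay.s ≤ Lay.len i * Lay.s := by
    have := Nat.mul_le_mul_right Lay.s hj; rw [Nat.succ_mul] at this; exact this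
  unfold ScanLayout.ptr
  refine ⟨by omega, by omega, by omega⟩

/-- Increment the stamp and clear the count: `stamp += 1; bad := 0`. [folklore] -/
def pre2 : List OpSpec := [(.add, .dir 90, .dir 90, .imm 1), (.add, .dir 91, .imm 0, .imm 0)]

/-- Record the triple and advance the innermost pointer:
`ok := (bad = 0); t := found + ok; found := (0 < t); p2 += s; c2 -= 1`. [folklore] -/
def post2 : List OpSpec :=
  [(.eq, .dir 85, .dir 91, .imm 0), (.add, .dir 85, .dir 81, .dir 85), (.lt, .dir 81, .imm 0, .dir 85),
    (.add, .dir 97, .dir 97, .dir 73), (.sub, .dir 94, .dir 94, .imm 1)]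

/-- The innermost body: one triple. [folklore] -/
def innerBody : SProg := seq (block pre2) (seq threeScans (block post2))

/-- `p2 := A 2; c2 := len 2`. [folklore] -/
def pre1 : List OpSpec := [(.add, .dir 97, .dir 76, .imm 0), (.add, .dir 94, .dir 79, .imm 0)]

/-- `p1 += s; c1 -= 1`. [folklore] -/
def post1 : List OpSpec := [(.add, .dir 96, .dir 96, .dir 73), (.sub, .dir 93, .dir 93, .imm 1)]

/-- The middle body: all triples with fixed first two coordinates… fixed first coordinate and one second coordinate. [folklore] -/
def middleBody : SProg := seq (block pre1) (seq (whilenz (.dir 94) innerBody) (block post1))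

/-- `p1 := A 1; c1 := len 1`. [folklore] -/
def pre0 : List OpSpec := [(.add, .dir 96, .dir 75, .imm 0), (.add, .dir 93, .dir 78, .imm 0)]

/-- `p0 += s; c0 -= 1`. [folklore] -/
def post0 : List OpSpec := [(.add, .dir 95, .dir 95, .dir 73), (.sub, .dir 92, .dir 92, .imm 1)]

/-- The outer body: all triples with a fixed first coordinate. [folklore] -/
def outerBody : SProg := seq (block pre0) (seq (whilenz (.dir 93) middleBody) (block post0))

/-- `p0 := A 0; c0 := len 0`. [folklore] -/
def scanSetup : List OpSpec := [(.add, .dir 95, .dir 74, .imm 0), (.add, .dir 92, .dir 77, .imm 0)]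

/-- **The brute-force scan over all triples of listed sets.** [cite: Pratt2024SCC, Problem 1.3] -/
def tripleScan : SProg := seq (block scanSetup) (whilenz (.dir 92) outerBody)

/-- The common part of the loop invariants: stamp, flag, table bound, frame, at rank `N`. [folklore] -/
structure BFCore (m : ℕ → ℕ) (Lay : ScanLayout) (qs : List (List ℕ)) (N : ℕ) (st : Store) : Prop where
  queries : st.queries = qs
  r90 : st.mem 90 = Lay.stamp₀ + N
  r81 : st.mem 81 = flagOf (ScanFlag m Lay N)
  table : ∀ e, e < Lay.E → st.mem (Lay.SB + e) ≤ Lay.stamp₀ + N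
  frame : ∀ c, c ≠ 81 → ¬ (82 ≤ c ∧ c ≤ 88) → ¬ (90 ≤ c ∧ c ≤ 97) → ¬ (Lay.SB ≤ c ∧ c < Lay.SB + Lay.E) →
    st.mem c = m c

/-- Invariant of the innermost loop. [folklore] -/
structure IInv (m : ℕ → ℕ) (Lay : ScanLayout) (qs : List (List ℕ)) (j₀ j₁ j₂ : ℕ) (st : Store) : Prop where
  core : BFCore m Lay qs (Lay.rank j₀ j₁ j₂) st
  r92 : st.mem 92 = Lay.len 0 - j₀
  r93 : st.mem 93 = Lay.len 1 - j₁
  r94 : st.mem 94 = Lay.len 2 - j₂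
  r95 : st.mem 95 = Lay.ptr 0 j₀
  r96 : st.mem 96 = Lay.ptr 1 j₁
  r97 : st.mem 97 = Lay.ptr 2 j₂

/-- Invariant of the middle loop. [folklore] -/
structure MInv (m : ℕ → ℕ) (Lay : ScanLayout) (qs : List (List ℕ)) (j₀ j₁ : ℕ) (st : Store) : Prop where
  core : BFCore m Lay qs (Lay.rank j₀ j₁ 0) st
  r92 : st.mem 92 = Lay.len 0 - j₀
  r93 : st.mem 93 = Lay.len 1 - j₁
  r95 : st.mem 95 = Lay.ptr 0 j₀
  r96 : st.mem 96 = Lay.ptr 1 j₁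

/-- Invariant of the outer loop. [folklore] -/
structure OInv (m : ℕ → ℕ) (Lay : ScanLayout) (qs : List (List ℕ)) (j₀ : ℕ) (st : Store) : Prop where
  core : BFCore m Lay qs (Lay.rank j₀ 0 0) st
  r92 : st.mem 92 = Lay.len 0 - j₀
  r95 : st.mem 95 = Lay.ptr 0 j₀

set_option linter.unusedSimpArgs false in
/-- **One triple.** [folklore] -/
theorem innerBody_spec {m : ℕ → ℕ} {Lay : ScanLayout} {qs : List (List ℕ)} {j₀ j₁ j₂ : ℕ}
    (hj₀ : j₀ < Lay.len 0) (hj₁ : j₁ < Lay.len 1) (hj₂ : j₂ < Lay.len 2) (hS : BFSide w m Lay)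
    (hR : BFRegs m Lay) {st : Store} (h : IInv m Lay qs j₀ j₁ j₂ st) :
    ∃ st', ExecLE w O innerBody st st' (Lay.n₀ * 30 + 16) ∧ IInv m Lay qs j₀ j₁ (j₂ + 1) st' := by
  obtain ⟨⟨hq, h90, h81, htab, hfr⟩, h92, h93, h94, h95, h96, h97⟩ := h
  obtain ⟨mm, qq⟩ := st
  simp only at hq h90 h81 htab hfr h92 h93 h94 h95 h96 h97
  subst qq
  set N := Lay.rank j₀ j₁ j₂ with hN
  have hNlt : N < Lay.rank (Lay.len 0) 0 0 := Lay.rank_lt hj₀ hj₁ hj₂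
  have hstamp := hS.hstamp
  have hSB := hS.hSB; have hSBE := hS.hSBE; have hs := hS.hs; have h3n := hS.h3n
  obtain ⟨hp0a, hp0b, hp0c⟩ := ptr_bounds (hS.hA 0 (by norm_num)) hs hj₀
  obtain ⟨hp1a, hp1b, hp1c⟩ := ptr_bounds (hS.hA 1 (by norm_num)) hs hj₁
  obtain ⟨hp2a, hp2b, hp2c⟩ := ptr_bounds (hS.hA 2 (by norm_num)) hs hj₂
  have hflag : flagOf (ScanFlag m Lay N) ≤ 1 := flagOf_le_one _
  -- pre2
  obtain ⟨st₁, hex₁, hP₁⟩ : ∃ st', Exec w O (block pre2) ⟨mm, qs⟩ st' 2 ∧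
      st'.queries = qs ∧ st'.mem 90 = Lay.stamp₀ + N + 1 ∧ st'.mem 91 = 0 ∧
      ∀ c, c ≠ 90 → c ≠ 91 → st'.mem c = mm c := by
    refine Exec.block_of_fwd pre2 qs fun Rf hR' => ?_
    unfold pre2 at hR'
    have htmp := execOps_cons_fwd hR'; clear hR'; obtain ⟨v1, hv1, hR'⟩ := htmp
    simp -failIfUnchanged (disch := omega) only [Operand.write, Operand.read,
      Function.update_self, Function.update_of_ne, BinOp.eval_add_mod', Nat.mod_eq_of_lt,
      Nat.add_zero, h90] at hv1 hR'
    subst v1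
    have htmp := execOps_cons_fwd hR'; clear hR'; obtain ⟨v2, hv2, hR'⟩ := htmp
    simp -failIfUnchanged (disch := omega) only [Operand.write, Operand.read,
      Function.update_self, Function.update_of_ne, BinOp.eval_add_mod', Nat.mod_eq_of_lt,
      Nat.add_zero] at hv2 hR'
    subst v2
    simp only [execOps_nil] at hR'
    subst hR'
    refine ⟨rfl, ?_, ?_, fun c h90' h91' => ?_⟩ <;> dsimp only
    · simp (disch := omega) only [Function.update_of_ne, Function.update_self]
    · simp (disch := omega) only [Function.update_of_ne, Function.update_self]
    · simp (disch := omega) only [Function.update_of_ne, Function.update_self]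
  obtain ⟨hq₁, g90, g91, gfr⟩ := hP₁
  obtain ⟨mm₁, qq₁⟩ := st₁
  simp only at hq₁ g90 g91 gfr
  subst qq₁
  have hrd₁ : ∀ c, c ≠ 81 → ¬ (82 ≤ c ∧ c ≤ 88) → ¬ (90 ≤ c ∧ c ≤ 97) →
      ¬ (Lay.SB ≤ c ∧ c < Lay.SB + Lay.E) → mm₁ c = m c := fun c h1 h2 h3 h4 => by
    rw [gfr c (by omega) (by omega)]; exact hfr c h1 h2 h3 h4
  -- the three scans
  obtain ⟨st₂, hex₂, hq₂, k91, ktab, kfr⟩ := threeScans_spec (w := w) (O := O)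
    (p := fun i => Lay.ptr i (if i = 0 then j₀ else if i = 1 then j₁ else j₂)) ⟨hSB, hSBE, by omega⟩
    (by rw [hrd₁ 3 (by omega) (by omega) (by omega) (by omega)]; exact hR.r3)
    (by rw [hrd₁ 89 (by omega) (by omega) (by omega) (by omega)]; exact hR.r89) g90 g91
    (by rw [gfr 95 (by omega) (by omega)]; simpa using h95)
    (by rw [gfr 96 (by omega) (by omega)]; simpa using h96)
    (by rw [gfr 97 (by omega) (by omega)]; simpa using h97)
    (fun i hi => by
      obtain rfl | rfl | rfl : i = 0 ∨ i = 1 ∨ i = 2 := by omega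
      · simpa using And.intro hp0a hp0b
      · simpa using And.intro hp1a hp1b
      · simpa using And.intro hp2a hp2b)
    (fun i hi => by
      obtain rfl | rfl | rfl : i = 0 ∨ i = 1 ∨ i = 2 := by omega
      · rcases hS.hAT 0 (by norm_num) with hh | hh
        · left; simp; unfold ScanLayout.ptr at hp0c ⊢; omega
        · right; simp; unfold ScanLayout.ptr; omega
      · rcases hS.hAT 1 (by norm_num) with hh | hh
        · left; simp; unfold ScanLayout.ptr at hp1c ⊢; omega
        · right; simp; unfold ScanLayout.ptr; omega
      · rcases hS.hAT 2 (by norm_num) with hh | hh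
        · left; simp; unfold ScanLayout.ptr at hp2c ⊢; omega
        · right; simp; unfold ScanLayout.ptr; omega)
    (fun i t hi ht => by
      obtain rfl | rfl | rfl : i = 0 ∨ i = 1 ∨ i = 2 := by omega
      · simp only [if_true]
        rw [hrd₁ _ (by omega) (by omega) (by omega)
          (by rcases hS.hAT 0 (by norm_num) with hh | hh <;> unfold ScanLayout.ptr at hp0c ⊢ <;> omega)]
        exact hS.hel 0 j₀ t (by norm_num) hj₀ ht
      · simp only [show (1 : ℕ) ≠ 0 by decide, if_false, if_true]
        rw [hrd₁ _ (by omega) (by omega) (by omega)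
          (by rcases hS.hAT 1 (by norm_num) with hh | hh <;> unfold ScanLayout.ptr at hp1c ⊢ <;> omega)]
        exact hS.hel 1 j₁ t (by norm_num) hj₁ ht
      · simp only [show (2 : ℕ) ≠ 0 by decide, show (2 : ℕ) ≠ 1 by decide, if_false]
        rw [hrd₁ _ (by omega) (by omega) (by omega)
          (by rcases hS.hAT 2 (by norm_num) with hh | hh <;> unfold ScanLayout.ptr at hp2c ⊢ <;> omega)]
        exact hS.hel 2 j₂ t (by norm_num) hj₂ ht)
    (by omega) (by omega) h3n
    (fun e he => by rw [gfr _ (by omega) (by omega)]; exact Nat.lt_succ_of_le (htab e he)) qs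
  simp only [if_true, show (1 : ℕ) ≠ 0 by decide, show (2 : ℕ) ≠ 0 by decide,
    show (2 : ℕ) ≠ 1 by decide, if_false] at k91
  -- the lists are those of the reference memory
  have hL : ∀ i j, i < 3 → j < Lay.len i →
      elemsAt mm₁ (Lay.ptr i j + 1) Lay.n₀ = elemsAt m (Lay.ptr i j + 1) Lay.n₀ := by
    intro i j hi hj
    obtain ⟨hpa, hpb, hpc⟩ := ptr_bounds (hS.hA i hi) hs hj
    refine elemsAt_congr fun t ht => hrd₁ _ (by omega) (by omega) (by omega) ?_
    rcases hS.hAT i hi with hh | hh <;> unfold ScanLayout.ptr at hpc ⊢ <;> omega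
  rw [hL 0 j₀ (by norm_num) hj₀, hL 1 j₁ (by norm_num) hj₁, hL 2 j₂ (by norm_num) hj₂] at k91
  -- goodness of the triple is `bad = 0`
  have hσ : ∀ e, tableAt mm₁ Lay.SB Lay.E e < Lay.stamp₀ + N + 1 := fun e => by
    unfold tableAt; split_ifs with he
    · rw [gfr _ (by omega) (by omega)]; exact Nat.lt_succ_of_le (htab e he)
    · omega
  have hgood : st₂.mem 91 = 0 ↔ goodTriple m Lay j₀ j₁ j₂ := by
    rw [k91, scan_snd_eq_iff_nodup hσ]; rfl
  -- post2
  obtain ⟨mm₂, qq₂⟩ := st₂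
  simp only at hq₂ k91 ktab kfr hgood
  subst qq₂
  have hrd₂ : ∀ c, c ≠ 81 → ¬ (82 ≤ c ∧ c ≤ 88) → ¬ (90 ≤ c ∧ c ≤ 97) →
      ¬ (Lay.SB ≤ c ∧ c < Lay.SB + Lay.E) → mm₂ c = m c := fun c h1 h2 h3 h4 => by
    rw [kfr c (by omega) (by omega) h4]; exact hrd₁ c h1 h2 h3 h4
  have e81 : mm₂ 81 = flagOf (ScanFlag m Lay N) := by
    rw [kfr 81 (by omega) (by omega) (by omega), gfr 81 (by omega) (by omega)]; exact h81
  have e97 : mm₂ 97 = Lay.ptr 2 j₂ := by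
    rw [kfr 97 (by omega) (by omega) (by omega), gfr 97 (by omega) (by omega)]; exact h97
  have e94 : mm₂ 94 = Lay.len 2 - j₂ := by
    rw [kfr 94 (by omega) (by omega) (by omega), gfr 94 (by omega) (by omega)]; exact h94
  have e73 : mm₂ 73 = Lay.s := by rw [hrd₂ 73 (by omega) (by omega) (by omega) (by omega)]; exact hR.r73
  have hok : (if mm₂ 91 = 0 then 1 else 0) ≤ 1 := by split_ifs <;> omega
  have hex₃ : Exec w O (block post2) ⟨mm₂, qs⟩ ⟨execOps w mm₂ post2, qs⟩ 5 := Exec.block' post2 qs rfl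
  refine ⟨⟨execOps w mm₂ post2, qs⟩, ((hex₁.execLE).seq (hex₂.seq hex₃.execLE)).mono (by omega), ?_⟩
  -- the final store, by symbolic evaluation of `post2`
  have hA2 := (hS.hA 2 (by norm_num)).2
  have hlen2 := hS.hlen 2 (by norm_num)
  have hev : execOps w mm₂ post2 =
      Function.update (Function.update (Function.update (Function.update (Function.update mm₂ 85
        (if mm₂ 91 = 0 then 1 else 0)) 85
        (flagOf (ScanFlag m Lay N) + (if mm₂ 91 = 0 then 1 else 0)))
        81 (if 0 < flagOf (ScanFlag m Lay N) + (if mm₂ 91 = 0 then 1 else 0) then 1 else 0))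
        97 (Lay.ptr 2 j₂ + Lay.s)) 94 (Lay.len 2 - j₂ - 1) := by
    unfold post2
    simp -failIfUnchanged (disch := omega) only [execOps_cons, execOps_nil, execOp, Operand.write,
      Operand.read, Function.update_self, Function.update_of_ne, BinOp.eval_add_mod',
      Nat.mod_eq_of_lt, BinOp.eval_sub_of_le, BinOp.eval_lt, BinOp.eval_eq, Nat.add_zero, e81, e97,
      e94, e73]
  rw [hev]
  have hrank : Lay.rank j₀ j₁ (j₂ + 1) = N + 1 := by rw [hN]; unfold ScanLayout.rank; omega
  refine ⟨⟨rfl, ?_, ?_, fun e he => ?_, fun c h1 h2 h3 h4 => ?_⟩, ?_, ?_, ?_, ?_, ?_, ?_⟩ <;> dsimp only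
  · simp (disch := omega) only [Function.update_of_ne, Function.update_self]
    rw [kfr 90 (by omega) (by omega) (by omega), g90, hrank]; omega
  · simp (disch := omega) only [Function.update_of_ne, Function.update_self]
    rw [hrank, (propext (scanFlag_succ m Lay hj₀ hj₁ hj₂) : ScanFlag m Lay (N + 1) = _), flagOf_or]
    congr 2
    by_cases hg : goodTriple m Lay j₀ j₁ j₂
    · rw [flagOf_pos hg, if_pos (hgood.2 hg)]
    · rw [flagOf_neg hg, if_neg (fun h0 => hg (hgood.1 h0))]
  · simp (disch := omega) only [Function.update_of_ne, Function.update_self]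
    rw [hrank]; have := ktab e he; omega
  · simp (disch := omega) only [Function.update_of_ne, Function.update_self]
    exact hrd₂ c h1 h2 h3 h4
  · simp (disch := omega) only [Function.update_of_ne, Function.update_self]
    rw [kfr 92 (by omega) (by omega) (by omega), gfr 92 (by omega) (by omega)]; exact h92
  · simp (disch := omega) only [Function.update_of_ne, Function.update_self]
    rw [kfr 93 (by omega) (by omega) (by omega), gfr 93 (by omega) (by omega)]; exact h93
  · simp (disch := omega) only [Function.update_of_ne, Function.update_self]; omega
  · simp (disch := omega) only [Function.update_of_ne, Function.update_self]
    rw [kfr 95 (by omega) (by omega) (by omega), gfr 95 (by omega) (by omega)]; exact h95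
  · simp (disch := omega) only [Function.update_of_ne, Function.update_self]
    rw [kfr 96 (by omega) (by omega) (by omega), gfr 96 (by omega) (by omega)]; exact h96
  · simp (disch := omega) only [Function.update_of_ne, Function.update_self]
    unfold ScanLayout.ptr; rw [Nat.succ_mul]; omega

/-- The innermost loop: all `len 2` triples with fixed `(j₀, j₁)`. [folklore] -/
theorem innerLoop_spec {m : ℕ → ℕ} {Lay : ScanLayout} {qs : List (List ℕ)} {j₀ j₁ : ℕ}
    (hj₀ : j₀ < Lay.len 0) (hj₁ : j₁ < Lay.len 1) (hS : BFSide w m Lay) (hR : BFRegs m Lay) {st : Store}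
    (h : IInv m Lay qs j₀ j₁ 0 st) :
    ∃ st', ExecLE w O (whilenz (.dir 94) innerBody) st st' (Lay.len 2 * (Lay.n₀ * 30 + 18) + 1) ∧
      IInv m Lay qs j₀ j₁ (Lay.len 2) st' :=
  ExecLE.whilenz_invariant (w := w) (O := O) (x := .dir 94) (s := innerBody) (Lay.len 2)
    (Lay.n₀ * 30 + 16) (fun j₂ st => IInv m Lay qs j₀ j₁ j₂ st)
    (fun j₂ hj₂ st hst => ⟨by rw [Operand.read_dir, hst.r94]; omega, innerBody_spec hj₀ hj₁ hj₂ hS hR hst⟩)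
    (fun st hst => by rw [Operand.read_dir, hst.r94]; omega) h

set_option linter.unusedSimpArgs false in
/-- **The middle body**: all triples with fixed `(j₀, j₁)`, then advance `j₁`. [folklore] -/
theorem middleBody_spec {m : ℕ → ℕ} {Lay : ScanLayout} {qs : List (List ℕ)} {j₀ j₁ : ℕ}
    (hj₀ : j₀ < Lay.len 0) (hj₁ : j₁ < Lay.len 1) (hS : BFSide w m Lay) (hR : BFRegs m Lay) {st : Store}
    (h : MInv m Lay qs j₀ j₁ st) :
    ∃ st', ExecLE w O middleBody st st' (Lay.len 2 * (Lay.n₀ * 30 + 18) + 5) ∧ MInv m Lay qs j₀ (j₁ + 1) st' := by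
  obtain ⟨⟨hq, h90, h81, htab, hfr⟩, h92, h93, h95, h96⟩ := h
  obtain ⟨mm, qq⟩ := st
  simp only at hq h90 h81 htab hfr h92 h93 h95 h96
  subst qq
  have hSB := hS.hSB
  have hA2 := hS.hA 2 (by norm_num); have hlen2 := hS.hlen 2 (by norm_num)
  have hA1 := hS.hA 1 (by norm_num); have hlen1 := hS.hlen 1 (by norm_num)
  obtain ⟨hp1a, hp1b, hp1c⟩ := ptr_bounds hA1 hS.hs hj₁
  have e76 : mm 76 = Lay.A 2 := by rw [hfr 76 (by omega) (by omega) (by omega) (by omega)]; exact hR.r76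
  have e79 : mm 79 = Lay.len 2 := by rw [hfr 79 (by omega) (by omega) (by omega) (by omega)]; exact hR.r79
  -- pre1
  have hev₁ : execOps w mm pre1 = Function.update (Function.update mm 97 (Lay.A 2)) 94 (Lay.len 2) := by
    unfold pre1
    simp -failIfUnchanged (disch := omega) only [execOps_cons, execOps_nil, execOp, Operand.write,
      Operand.read, Function.update_self, Function.update_of_ne, BinOp.eval_add_mod',
      Nat.mod_eq_of_lt, Nat.add_zero, e76, e79]
  have hex₁ : Exec w O (block pre1) ⟨mm, qs⟩ ⟨execOps w mm pre1, qs⟩ 2 := Exec.block' pre1 qs rfl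
  rw [hev₁] at hex₁
  have hI : IInv m Lay qs j₀ j₁ 0 ⟨Function.update (Function.update mm 97 (Lay.A 2)) 94 (Lay.len 2), qs⟩ := by
    have hr0 : Lay.rank j₀ j₁ 0 = Lay.rank j₀ j₁ 0 := rfl
    refine ⟨⟨rfl, ?_, ?_, fun e he => ?_, fun c h1 h2 h3 h4 => ?_⟩, ?_, ?_, ?_, ?_, ?_, ?_⟩ <;> dsimp only
    · simp (disch := omega) only [Function.update_of_ne, Function.update_self]; exact h90
    · simp (disch := omega) only [Function.update_of_ne, Function.update_self]; exact h81
    · simp (disch := omega) only [Function.update_of_ne, Function.update_self]; exact htab e he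
    · simp (disch := omega) only [Function.update_of_ne, Function.update_self]; exact hfr c h1 h2 h3 h4
    · simp (disch := omega) only [Function.update_of_ne, Function.update_self]; exact h92
    · simp (disch := omega) only [Function.update_of_ne, Function.update_self]; exact h93
    · simp (disch := omega) only [Function.update_of_ne, Function.update_self]; omega
    · simp (disch := omega) only [Function.update_of_ne, Function.update_self]; exact h95
    · simp (disch := omega) only [Function.update_of_ne, Function.update_self]; exact h96
    · simp (disch := omega) only [Function.update_of_ne, Function.update_self]
      unfold ScanLayout.ptr; omega
  obtain ⟨st₂, hex₂, hI₂⟩ := innerLoop_spec (w := w) (O := O) hj₀ hj₁ hS hR hI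
  -- post1
  obtain ⟨⟨hq₂, k90, k81, ktab, kfr⟩, k92, k93, k94, k95, k96, k97⟩ := hI₂
  obtain ⟨mm₂, qq₂⟩ := st₂
  simp only at hq₂ k90 k81 ktab kfr k92 k93 k94 k95 k96 k97
  subst qq₂
  have f73 : mm₂ 73 = Lay.s := by rw [kfr 73 (by omega) (by omega) (by omega) (by omega)]; exact hR.r73
  have hev₃ : execOps w mm₂ post1 =
      Function.update (Function.update mm₂ 96 (Lay.ptr 1 j₁ + Lay.s)) 93 (Lay.len 1 - j₁ - 1) := by
    unfold post1
    simp -failIfUnchanged (disch := omega) only [execOps_cons, execOps_nil, execOp, Operand.write,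
      Operand.read, Function.update_self, Function.update_of_ne, BinOp.eval_add_mod',
      Nat.mod_eq_of_lt, BinOp.eval_sub_of_le, Nat.add_zero, k96, k93, f73]
  have hex₃ : Exec w O (block post1) ⟨mm₂, qs⟩ ⟨execOps w mm₂ post1, qs⟩ 2 := Exec.block' post1 qs rfl
  rw [hev₃] at hex₃
  refine ⟨_, ((hex₁.execLE).seq (hex₂.seq hex₃.execLE)).mono (by omega), ?_⟩
  have hrank : Lay.rank j₀ (j₁ + 1) 0 = Lay.rank j₀ j₁ (Lay.len 2) := by
    unfold ScanLayout.rank; ring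
  refine ⟨⟨rfl, ?_, ?_, fun e he => ?_, fun c h1 h2 h3 h4 => ?_⟩, ?_, ?_, ?_, ?_⟩ <;> dsimp only
  · simp (disch := omega) only [Function.update_of_ne, Function.update_self]; rw [hrank]; exact k90
  · simp (disch := omega) only [Function.update_of_ne, Function.update_self]; rw [hrank]; exact k81
  · simp (disch := omega) only [Function.update_of_ne, Function.update_self]; rw [hrank]; exact ktab e he
  · simp (disch := omega) only [Function.update_of_ne, Function.update_self]; exact kfr c h1 h2 h3 h4
  · simp (disch := omega) only [Function.update_of_ne, Function.update_self]; exact k92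
  · simp (disch := omega) only [Function.update_of_ne, Function.update_self]; omega
  · simp (disch := omega) only [Function.update_of_ne, Function.update_self]; exact k95
  · simp (disch := omega) only [Function.update_of_ne, Function.update_self]
    unfold ScanLayout.ptr; rw [Nat.succ_mul]; omega

/-- The middle loop: all triples with fixed `j₀`. [folklore] -/
theorem middleLoop_spec {m : ℕ → ℕ} {Lay : ScanLayout} {qs : List (List ℕ)} {j₀ : ℕ}
    (hj₀ : j₀ < Lay.len 0) (hS : BFSide w m Lay) (hR : BFRegs m Lay) {st : Store} (h : MInv m Lay qs j₀ 0 st) :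
    ∃ st', ExecLE w O (whilenz (.dir 93) middleBody) st st'
      (Lay.len 1 * (Lay.len 2 * (Lay.n₀ * 30 + 18) + 7) + 1) ∧ MInv m Lay qs j₀ (Lay.len 1) st' :=
  ExecLE.whilenz_invariant (w := w) (O := O) (x := .dir 93) (s := middleBody) (Lay.len 1)
    (Lay.len 2 * (Lay.n₀ * 30 + 18) + 5) (fun j₁ st => MInv m Lay qs j₀ j₁ st)
    (fun j₁ hj₁ st hst => ⟨by rw [Operand.read_dir, hst.r93]; omega, middleBody_spec hj₀ hj₁ hS hR hst⟩)
    (fun st hst => by rw [Operand.read_dir, hst.r93]; omega) h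

set_option linter.unusedSimpArgs false in
/-- **The outer body**: all triples with fixed `j₀`, then advance `j₀`. [folklore] -/
theorem outerBody_spec {m : ℕ → ℕ} {Lay : ScanLayout} {qs : List (List ℕ)} {j₀ : ℕ}
    (hj₀ : j₀ < Lay.len 0) (hS : BFSide w m Lay) (hR : BFRegs m Lay) {st : Store} (h : OInv m Lay qs j₀ st) :
    ∃ st', ExecLE w O outerBody st st' (Lay.len 1 * (Lay.len 2 * (Lay.n₀ * 30 + 18) + 7) + 5) ∧
      OInv m Lay qs (j₀ + 1) st' := by
  obtain ⟨⟨hq, h90, h81, htab, hfr⟩, h92, h95⟩ := h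
  obtain ⟨mm, qq⟩ := st
  simp only at hq h90 h81 htab hfr h92 h95
  subst qq
  have hSB := hS.hSB
  have hA1 := hS.hA 1 (by norm_num); have hlen1 := hS.hlen 1 (by norm_num)
  have hA0 := hS.hA 0 (by norm_num); have hlen0 := hS.hlen 0 (by norm_num)
  obtain ⟨hp0a, hp0b, hp0c⟩ := ptr_bounds hA0 hS.hs hj₀
  have e75 : mm 75 = Lay.A 1 := by rw [hfr 75 (by omega) (by omega) (by omega) (by omega)]; exact hR.r75
  have e78 : mm 78 = Lay.len 1 := by rw [hfr 78 (by omega) (by omega) (by omega) (by omega)]; exact hR.r78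
  have hev₁ : execOps w mm pre0 = Function.update (Function.update mm 96 (Lay.A 1)) 93 (Lay.len 1) := by
    unfold pre0
    simp -failIfUnchanged (disch := omega) only [execOps_cons, execOps_nil, execOp, Operand.write,
      Operand.read, Function.update_self, Function.update_of_ne, BinOp.eval_add_mod',
      Nat.mod_eq_of_lt, Nat.add_zero, e75, e78]
  have hex₁ : Exec w O (block pre0) ⟨mm, qs⟩ ⟨execOps w mm pre0, qs⟩ 2 := Exec.block' pre0 qs rfl
  rw [hev₁] at hex₁
  have hM : MInv m Lay qs j₀ 0 ⟨Function.update (Function.update mm 96 (Lay.A 1)) 93 (Lay.len 1), qs⟩ := by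
    refine ⟨⟨rfl, ?_, ?_, fun e he => ?_, fun c h1 h2 h3 h4 => ?_⟩, ?_, ?_, ?_, ?_⟩ <;> dsimp only
    · simp (disch := omega) only [Function.update_of_ne, Function.update_self]; exact h90
    · simp (disch := omega) only [Function.update_of_ne, Function.update_self]; exact h81
    · simp (disch := omega) only [Function.update_of_ne, Function.update_self]; exact htab e he
    · simp (disch := omega) only [Function.update_of_ne, Function.update_self]; exact hfr c h1 h2 h3 h4
    · simp (disch := omega) only [Function.update_of_ne, Function.update_self]; exact h92
    · simp (disch := omega) only [Function.update_of_ne, Function.update_self]; omega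
    · simp (disch := omega) only [Function.update_of_ne, Function.update_self]; exact h95
    · simp (disch := omega) only [Function.update_of_ne, Function.update_self]
      unfold ScanLayout.ptr; omega
  obtain ⟨st₂, hex₂, hM₂⟩ := middleLoop_spec (w := w) (O := O) hj₀ hS hR hM
  obtain ⟨⟨hq₂, k90, k81, ktab, kfr⟩, k92, k93, k95, k96⟩ := hM₂
  obtain ⟨mm₂, qq₂⟩ := st₂
  simp only at hq₂ k90 k81 ktab kfr k92 k93 k95 k96
  subst qq₂
  have f73 : mm₂ 73 = Lay.s := by rw [kfr 73 (by omega) (by omega) (by omega) (by omega)]; exact hR.r73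
  have hev₃ : execOps w mm₂ post0 =
      Function.update (Function.update mm₂ 95 (Lay.ptr 0 j₀ + Lay.s)) 92 (Lay.len 0 - j₀ - 1) := by
    unfold post0
    simp -failIfUnchanged (disch := omega) only [execOps_cons, execOps_nil, execOp, Operand.write,
      Operand.read, Function.update_self, Function.update_of_ne, BinOp.eval_add_mod',
      Nat.mod_eq_of_lt, BinOp.eval_sub_of_le, Nat.add_zero, k95, k92, f73]
  have hex₃ : Exec w O (block post0) ⟨mm₂, qs⟩ ⟨execOps w mm₂ post0, qs⟩ 2 := Exec.block' post0 qs rfl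
  rw [hev₃] at hex₃
  refine ⟨_, ((hex₁.execLE).seq (hex₂.seq hex₃.execLE)).mono (by omega), ?_⟩
  have hrank : Lay.rank (j₀ + 1) 0 0 = Lay.rank j₀ (Lay.len 1) 0 := by
    unfold ScanLayout.rank; ring
  refine ⟨⟨rfl, ?_, ?_, fun e he => ?_, fun c h1 h2 h3 h4 => ?_⟩, ?_, ?_⟩ <;> dsimp only
  · simp (disch := omega) only [Function.update_of_ne, Function.update_self]; rw [hrank]; exact k90
  · simp (disch := omega) only [Function.update_of_ne, Function.update_self]; rw [hrank]; exact k81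
  · simp (disch := omega) only [Function.update_of_ne, Function.update_self]; rw [hrank]; exact ktab e he
  · simp (disch := omega) only [Function.update_of_ne, Function.update_self]; exact kfr c h1 h2 h3 h4
  · simp (disch := omega) only [Function.update_of_ne, Function.update_self]; omega
  · simp (disch := omega) only [Function.update_of_ne, Function.update_self]
    unfold ScanLayout.ptr; rw [Nat.succ_mul]; omega

/-- A step bound of the whole scan. [folklore] -/
def scanTime (Lay : ScanLayout) : ℕ :=
  Lay.len 0 * (Lay.len 1 * (Lay.len 2 * (Lay.n₀ * 30 + 18) + 7) + 7) + 3

set_option linter.unusedSimpArgs false in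
/-- **The brute-force scan.** From a memory `m` with the layout registers (`BFRegs`) and the side
conditions `BFSide` (in particular every table entry `≤ stamp₀`, and room for `len 0 · len 1 · len 2`
more stamps), `tripleScan` ends within `scanTime` steps with the flag register `81` equal to
`flagOf (found₀ ≠ 0 ∨ ∃ a < len 0, b < len 1, c < len 2, goodTriple m Lay a b c)` — the old flag,
or SOME triple of listed sets has `3 n₀` pairwise distinct elements — and nothing changed outside
`81–88`, `90–97` and the stamp table. [cite: Pratt2024SCC, Problem 1.3] -/
theorem tripleScan_spec {m : ℕ → ℕ} {Lay : ScanLayout} (hS : BFSide w m Lay) (hR : BFRegs m Lay)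
    (qs : List (List ℕ)) :
    ∃ st', ExecLE w O tripleScan ⟨m, qs⟩ st' (scanTime Lay) ∧ st'.queries = qs ∧
      st'.mem 81 = flagOf (Lay.found₀ ≠ 0 ∨ ∃ a b c, a < Lay.len 0 ∧ b < Lay.len 1 ∧ c < Lay.len 2 ∧
        goodTriple m Lay a b c) ∧
      (∀ c, c ≠ 81 → ¬ (82 ≤ c ∧ c ≤ 88) → ¬ (90 ≤ c ∧ c ≤ 97) → ¬ (Lay.SB ≤ c ∧ c < Lay.SB + Lay.E) →
        st'.mem c = m c) := by
  have hSB := hS.hSB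
  have hA0 := hS.hA 0 (by norm_num); have hlen0 := hS.hlen 0 (by norm_num)
  have hev₁ : execOps w m scanSetup = Function.update (Function.update m 95 (Lay.A 0)) 92 (Lay.len 0) := by
    unfold scanSetup
    simp -failIfUnchanged (disch := omega) only [execOps_cons, execOps_nil, execOp, Operand.write,
      Operand.read, Function.update_self, Function.update_of_ne, BinOp.eval_add_mod',
      Nat.mod_eq_of_lt, Nat.add_zero, hR.r74, hR.r77]
  have hex₁ : Exec w O (block scanSetup) ⟨m, qs⟩ ⟨execOps w m scanSetup, qs⟩ 2 := Exec.block' scanSetup qs rfl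
  rw [hev₁] at hex₁
  have h0 : Lay.rank 0 0 0 = 0 := by unfold ScanLayout.rank; simp
  have hflag0 : flagOf (ScanFlag m Lay 0) = Lay.found₀ := by
    rw [(propext (scanFlag_zero m Lay) : ScanFlag m Lay 0 = _)]
    have := hS.hfound
    by_cases hf : Lay.found₀ = 0
    · rw [flagOf_neg (by simpa using hf), hf]
    · rw [flagOf_pos hf]; omega
  have hO : OInv m Lay qs 0 ⟨Function.update (Function.update m 95 (Lay.A 0)) 92 (Lay.len 0), qs⟩ := by
    refine ⟨⟨rfl, ?_, ?_, fun e he => ?_, fun c h1 h2 h3 h4 => ?_⟩, ?_, ?_⟩ <;> dsimp only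
    · simp (disch := omega) only [Function.update_of_ne, Function.update_self]; rw [h0]; simpa using hR.r90
    · simp (disch := omega) only [Function.update_of_ne, Function.update_self]; rw [h0, hflag0]; exact hR.r81
    · simp (disch := omega) only [Function.update_of_ne, Function.update_self]; rw [h0]
      simpa using hS.htab e he
    · simp (disch := omega) only [Function.update_of_ne, Function.update_self]
    · simp (disch := omega) only [Function.update_of_ne, Function.update_self]; omega
    · simp (disch := omega) only [Function.update_of_ne, Function.update_self]
      unfold ScanLayout.ptr; omega
  obtain ⟨st₂, hex₂, hO₂⟩ := ExecLE.whilenz_invariant (w := w) (O := O) (x := .dir 92) (s := outerBody)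
    (Lay.len 0) (Lay.len 1 * (Lay.len 2 * (Lay.n₀ * 30 + 18) + 7) + 5) (fun j₀ st => OInv m Lay qs j₀ st)
    (fun j₀ hj₀ st hst => ⟨by rw [Operand.read_dir, hst.r92]; omega, outerBody_spec hj₀ hS hR hst⟩)
    (fun st hst => by rw [Operand.read_dir, hst.r92]; omega) hO
  refine ⟨st₂, (ExecLE.seq hex₁.execLE hex₂).mono ?_, hO₂.core.queries, ?_, hO₂.core.frame⟩
  · unfold scanTime
    rw [show Lay.len 1 * (Lay.len 2 * (Lay.n₀ * 30 + 18) + 7) + 5 + 2 =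
      Lay.len 1 * (Lay.len 2 * (Lay.n₀ * 30 + 18) + 7) + 7 by omega]
    omega
  · rw [hO₂.core.r81, (propext (scanFlag_final m Lay) : ScanFlag m Lay _ = _)]

end SProg

end Literature.Computability.Cryptography.WordRAM
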